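import Summits.AnomalousDissipation.AnomalousDissipation.Theorems.SolenoidalFractalHomogenisationLagrangianStepVmodFlatBlocks
import Summits.AnomalousDissipation.AnomalousDissipation.Theorems.SolenoidalFractalHomogenisationLagrangianStepPairData
import HarnessLib

/-!
# K1L_D (stmt-AnomalousDissipation-27980): (V_mod) flat stage, block (ss) — SPLITTING A CLASS-PAIR STATE INTO ITS SLOW PAIR AND ITS FAST PART
(helper; `--supports 27980 --as helper`; prover ad-sawtooth-k1loc-p1 g15; bookkeeping for the iteration T-I of the certifier's table, row «C / coarse / y ≥ 1»:
at every grid restart the state `z = U(s₀, s_j)v` is split into the single real mode pair `a` it carries at `±ℓ` — to which (V) applies — and the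
fast remainder `f = z − a` — to which the leakage bound `…VmodLeakSlow` and the fast-content bound `…VmodLeakEnergy` apply.)

**`exists_pair_split`** — for `ℓ ≠ 0` and a weakly divergence-free `z ∈ V2`: `z = a + f` with `a` the real single mode
`toLp (realTrigPoly {ℓ} (2•𝓕z(ℓ)))` (weakly divergence free, supported on `{ℓ, −ℓ}`, `𝓕a(±ℓ) = 𝓕z(±ℓ)`, `‖a‖² = 2‖𝓕z(ℓ)‖²`) and `f` weakly
divergence free with `𝓕f(±ℓ) = 0`, `𝓕f(k) = 𝓕z(k)` off the pair, `‖f‖² = ‖z‖² − (‖𝓕z(ℓ)‖² + ‖𝓕z(−ℓ)‖²)`; in particular `f` inherits any support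
condition of `z` off the pair (class-pair support).  Parseval on `V2` (`hasSum_norm_sq_fcoeff`), conjugate symmetry of real coefficients, and the
coefficient formula of a single real mode (`mFourierCoeff_realTrigPoly_singleton`).
`sorry`-free; NOT a proof of (ss), of the stub, of K1L_D or of AD; rung F-D1.A0.
-/

set_option linter.dupNamespace false

noncomputable section

namespace Summit.AnomalousDissipation.AnomalousDissipation.Theorems.SolenoidalFractalHomogenisation.LagrangianStep.VmodGen

open Set MeasureTheory Complex UnitAddTorus
open scoped InnerProductSpace ENNReal
open Literature.Analysis Literature.Analysis.FunctionSpaces Literature.Analysis.FunctionSpaces.Torus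
open Literature.Analysis.FluidPDE Literature.Analysis.FluidPDE.Torus
open Summit.AnomalousDissipation.AnomalousDissipation.Theorems.SolenoidalFractalHomogenisation.LagrangianStep.VmodFlat (fc fc_sub)

set_option maxHeartbeats 800000 in
/-- **SLOW PAIR / FAST PART SPLIT of a weakly divergence-free `V2` state at the label `ℓ ≠ 0`.**  See the module docstring.
[cite: Grafakos2014, Prop. 3.2.7 (3)] -/
theorem exists_pair_split {ℓ : Fin 3 → ℤ} (hℓ : ℓ ≠ 0) (z : V2) (hz : z ∈ divFreeL2 (Fin 3)) :
    ∃ a f : V2, z = a + f ∧ a ∈ divFreeL2 (Fin 3) ∧ f ∈ divFreeL2 (Fin 3) ∧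
      (∀ k', k' ≠ ℓ → k' ≠ -ℓ → fc a k' = 0) ∧ fc a ℓ = fc z ℓ ∧ fc a (-ℓ) = fc z (-ℓ) ∧
      fc f ℓ = 0 ∧ fc f (-ℓ) = 0 ∧ (∀ k', k' ≠ ℓ → k' ≠ -ℓ → fc f k' = fc z k') ∧
      ‖a‖ ^ 2 = 2 * ‖fc z ℓ‖ ^ 2 ∧ ‖f‖ ^ 2 = ‖z‖ ^ 2 - (‖fc z ℓ‖ ^ 2 + ‖fc z (-ℓ)‖ ^ 2) := by
  classical
  have hne : ℓ ≠ -ℓ := fun h' => hℓ (by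
    funext i; have hi := congrFun h' i; simp only [Pi.neg_apply] at hi; have : ℓ i = 0 := by omega
    simpa using this)
  have hne' : -ℓ ≠ ℓ := fun h => hne h.symm
  -- the single real mode carried by `z` at `±ℓ`
  set c : EuclideanSpace ℂ (Fin 3) := fc z ℓ with hc
  set F : VF := FunctionSpaces.Torus.realTrigPoly {ℓ} (fun _ => (2:ℂ) • c) with hF
  have hF2 : MemLp F 2 volume := FunctionSpaces.Torus.memLp_realTrigPoly {ℓ} _ 2
  set a : V2 := hF2.toLp F with ha
  have hzi : Integrable (z : VF) volume := integrable_coe_V2 z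
  have hsymm : fc z (-ℓ) = EuclideanSpace.conjVec (fc z ℓ) := isConjSymm_mFourierCoeff hzi ℓ
  -- coefficients of `a`
  have hacoef : ∀ k', fc a k' = (2 : ℂ)⁻¹ • ((if k' = ℓ then (2:ℂ) • c else 0) + EuclideanSpace.conjVec (if k' = -ℓ then (2:ℂ) • c else 0)) := by
    intro k'
    show mFourierCoeff (EuclideanSpace.complexify ∘ ⇑(hF2.toLp F)) k' = _
    rw [FunctionSpaces.Torus.mFourierCoeff_congr_ae (Filter.EventuallyEq.fun_comp (MemLp.coeFn_toLp hF2) EuclideanSpace.complexify) k']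
    exact FunctionSpaces.Torus.mFourierCoeff_realTrigPoly_singleton ℓ _ k'
  have haℓ : fc a ℓ = fc z ℓ := by
    rw [hacoef, if_pos rfl, if_neg hne, EuclideanSpace.conjVec_zero, add_zero, smul_smul]; norm_num; exact hc
  have hanℓ : fc a (-ℓ) = fc z (-ℓ) := by
    rw [hacoef, if_neg hne', if_pos rfl, zero_add, EuclideanSpace.conjVec_smul, smul_smul, map_ofNat, hsymm]; norm_num; rw [hc]
  have haoff : ∀ k', k' ≠ ℓ → k' ≠ -ℓ → fc a k' = 0 := by
    intro k' h1 h2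
    rw [hacoef, if_neg h1, if_neg h2, EuclideanSpace.conjVec_zero, add_zero, smul_zero]
  -- `a` is weakly divergence free (transversal coefficient)
  have hdivz : ∑ j, (ℓ j : ℂ) * ((2:ℂ) • c) j = 0 := by
    have h0 := FunctionSpaces.Torus.IsWeaklyDivFree.sum_mul_mFourierCoeff_eq_zero (Lp.memLp z) ((mem_divFreeL2_iff z).1 hz) ℓ
    simp only [PiLp.smul_apply, smul_eq_mul]
    rw [show ∑ j, (ℓ j : ℂ) * (2 * c j) = 2 * ∑ j, (ℓ j : ℂ) * c j by rw [Finset.mul_sum]; ring_nf, hc]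
    rw [show (∑ j, (ℓ j : ℂ) * fc z ℓ j) = 0 from h0, mul_zero]
  have hFdiv : FunctionSpaces.Torus.IsWeaklyDivFree F :=
    (FunctionSpaces.Torus.isDivFree_realTrigPoly_singleton (c := fun _ => (2:ℂ) • c) hdivz).isWeaklyDivFree_holds
      (FunctionSpaces.Torus.isSmooth_realTrigPoly _ _)
  have hadiv : a ∈ divFreeL2 (Fin 3) := (mem_divFreeL2_iff a).2 (hFdiv.congr_ae (MemLp.coeFn_toLp hF2).symm)
  set f : V2 := z - a with hf
  have hfdiv : f ∈ divFreeL2 (Fin 3) := (divFreeL2 (Fin 3)).sub_mem hz hadiv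
  have hfcoef : ∀ k', fc f k' = fc z k' - fc a k' := fun k' => fc_sub z a k'
  refine ⟨a, f, by rw [hf]; abel, hadiv, hfdiv, haoff, haℓ, hanℓ, ?_, ?_, ?_, ?_, ?_⟩
  · rw [hfcoef, haℓ, sub_self]
  · rw [hfcoef, hanℓ, sub_self]
  · intro k' h1 h2; rw [hfcoef, haoff k' h1 h2, sub_zero]
  · -- `‖a‖² = ‖𝓕a(ℓ)‖² + ‖𝓕a(−ℓ)‖² = 2‖𝓕z(ℓ)‖²`
    have hpars := hasSum_norm_sq_fcoeff a
    have hfin : HasSum (fun k' => ‖fc a k'‖ ^ 2) (∑ k' ∈ ({ℓ, -ℓ} : Finset (Fin 3 → ℤ)), ‖fc a k'‖ ^ 2) := by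
      refine hasSum_sum_of_ne_finset_zero fun k' hk' => ?_
      rw [Finset.mem_insert, Finset.mem_singleton, not_or] at hk'
      rw [haoff k' hk'.1 hk'.2, norm_zero, zero_pow two_ne_zero]
    have e := hpars.unique hfin
    rw [Finset.sum_pair hne, haℓ, hanℓ, hsymm, EuclideanSpace.norm_conjVec] at e
    rw [e]; ring
  · -- `‖f‖² = ‖z‖² − pair part`
    have hparsf := hasSum_norm_sq_fcoeff f
    have hparsz := hasSum_norm_sq_fcoeff z
    -- `‖𝓕f(k)‖² = ‖𝓕z(k)‖² − [k ∈ pair]‖𝓕z(k)‖²`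
    have hterm : ∀ k', ‖fc f k'‖ ^ 2 = ‖fc z k'‖ ^ 2 - (if k' = ℓ ∨ k' = -ℓ then ‖fc z k'‖ ^ 2 else 0) := by
      intro k'
      by_cases h1 : k' = ℓ
      · subst h1; rw [hfcoef, haℓ, sub_self, norm_zero, if_pos (Or.inl rfl)]; ring
      · by_cases h2 : k' = -ℓ
        · subst h2; rw [hfcoef, hanℓ, sub_self, norm_zero, if_pos (Or.inr rfl)]; ring
        · rw [hfcoef, haoff k' h1 h2, sub_zero, if_neg (not_or.2 ⟨h1, h2⟩), sub_zero]
    have hind : HasSum (fun k' : Fin 3 → ℤ => if k' = ℓ ∨ k' = -ℓ then ‖fc z k'‖ ^ 2 else 0)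
        (∑ k' ∈ ({ℓ, -ℓ} : Finset (Fin 3 → ℤ)), ‖fc z k'‖ ^ 2) := by
      have e : ∑ k' ∈ ({ℓ, -ℓ} : Finset (Fin 3 → ℤ)), ‖fc z k'‖ ^ 2 =
          ∑ k' ∈ ({ℓ, -ℓ} : Finset (Fin 3 → ℤ)), (if k' = ℓ ∨ k' = -ℓ then ‖fc z k'‖ ^ 2 else 0) :=
        Finset.sum_congr rfl fun k' hk' => by
          rw [Finset.mem_insert, Finset.mem_singleton] at hk'
          rw [if_pos hk']
      rw [e]
      refine hasSum_sum_of_ne_finset_zero fun k' hk' => ?_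
      rw [Finset.mem_insert, Finset.mem_singleton] at hk'
      rw [if_neg hk']
    have hdiff : HasSum (fun k' => ‖fc f k'‖ ^ 2) (‖z‖ ^ 2 - ∑ k' ∈ ({ℓ, -ℓ} : Finset (Fin 3 → ℤ)), ‖fc z k'‖ ^ 2) := by
      have h := hparsz.sub hind
      refine h.congr_fun fun k' => ?_
      rw [hterm k']
      rfl
    rw [hparsf.unique hdiff, Finset.sum_pair hne]

end Summit.AnomalousDissipation.AnomalousDissipation.Theorems.SolenoidalFractalHomogenisation.LagrangianStep.VmodGen

end
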